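import Literature.Algebra.Homology.DiscreteRepLayerBoundary
import Literature.NumberTheory.GaloisRepresentations.IdeleClassBarInvariant
import HarnessLib

/-!
# `inv_F(ŷ ∘ ∂(u))` on the layer: for `ŷ = Inf_E c`, `inv_F (ŷ ∘ ∂_{C̄}(u)) = inv_{E/F}(iso_E (u^{U_E}_* (δ c)))`
# (the E-side of step (R4) of the presentation road to Milne ADT I Thm. 4.10; Tate C–F VII §11.2 (bis))

Topic `NumberTheory/GaloisRepresentations`; namespace `Literature.NumberTheory.GaloisRepresentations.IdeleClassBar`.
Sequel to door-c4 g17's generic `DiscreteRepLayerBoundary.lean` (`LayerColimit.inflG_comp_boundary`: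
`Inf_U c ∘ ∂_X(u) = Inf_U (u^U_* (δ_{S^U} c))`) and door-c4 g16's `IdeleClassBarInvariant.lean` (`classBarInv_inflG`:
`inv_F (Inf_E c) = layerInv E c = inv_{E/F}(iso_E c)`).  Theorems only (no definition, no named fact, no instance, no notation,
no `sorry`).

THE POINT.  In door-c6 g16's F8 skeleton `middleExact_allPlaces_of_readout` (Summits,
`SchneiderFreeAdditiveX3PoitouTatePresentationRoad`) the hypothesis (R4) asks for the value
`classBarInv K (ŷ ∘ ∂_{C̄}(f ≫ (J̄ → C̄)))` for `ŷ ∈ Ext¹_{C_Γ}(ℤ, N)` and `f : N₁ → J̄` out of the kernel of the presentation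
`S : 0 → N₁ → P → N → 0`.  By door-c4's (d) every `ŷ` is `Inf_E c` for a layer `E` and `c ∈ H¹(Γ_F ⧸ U_E, N^{U_E})`
(`LayerColimit.exists_inflG_eq`); when the layer sequence `S^{U_E}` is short exact (`U_E` trivial on `P`:
`shortExact_map_invariantsQuotFunctor`):

  **`classBarInv F (Inf_E c ∘ ∂_{C̄}(u)) = layerInv E (u^{U_E}_* (δ_{S^{U_E}} c)) = inv_{E/F}(iso_E (u^{U_E}_* (δ_{S^{U_E}} c)))`**

(`classBarInv_inflG_comp_boundary`, `…_eq_classInvAll`) — a FINITE-LAYER expression in the cell's `inv_{E/F} = classInvAll F E`,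
the starting point of the finite-level computation `inv_{E/F}((g_E f_E)_* δ_fin y₀) = Σ_v inv_v(…)` of FINDING-door-c6-g16 §2
(door-c5's dictionary `functor_map_comp_layerCohomologyIso`, `classInvAll = Σ_v inv_v`).

HONEST FRAMING: bookkeeping; no arithmetic beyond the definitions, no case of BSD or of Poitou–Tate.  Route A (R4, E-side) of crux
`AnticycControlAdditiveK` (item 19295, cell bsd-schneider), seat door-c4 gen 17.

## References
* J. S. Milne, *Arithmetic Duality Theorems* (2nd ed. 2006), I §4, proof of Theorem 4.10 (p. 58). [MilneADT2006]
* J. W. S. Cassels, A. Fröhlich (eds.), *Algebraic Number Theory* (1967), Ch. VII (J. Tate) §11.2 (bis). [CasselsFrohlichANT1967]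
* J.-P. Serre, *Galois Cohomology* (1997), I §2.2 Proposition 8. [SerreGaloisCohomology1997]
-/

noncomputable section

open NumberField CategoryTheory CategoryTheory.Abelian groupCohomology
open Field (absoluteGaloisGroup)
open Literature.Algebra.Homology Literature.Algebra.Homology.DiscreteRep
open scoped Classical

namespace Literature.NumberTheory.GaloisRepresentations

namespace IdeleClassBar

variable {F : Type} [Field F] [NumberField F]
variable [CompactSpace (absoluteGaloisGroup F)] [TotallyDisconnectedSpace (absoluteGaloisGroup F)]

/-- **`inv_F (Inf_E c ∘ ∂_{C̄}(u)) = layerInv E (u^{U_E}_* (δ c))`**: for a short exact `S : 0 → X₁ → X₂ → X₃ → 0` of `C_Γ` whose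
layer sequence at `U_E` is short exact, a layer class `c ∈ H¹(Γ_F ⧸ U_E, X₃^{U_E})` and `u : X₁ → C̄`, the invariant of the
Yoneda product of `Inf_E c` with the boundary `∂_{C̄}(u)` (door-c6 `ExtPresentation.boundary`) is the layer invariant of the
finite-level class `H²(id, u^{U_E}) (δ_{S^{U_E}} c) ∈ H²(Γ_F ⧸ U_E, C̄^{U_E})`.
[cite: MilneADT2006, I §4, proof of Theorem 4.10][cite: CasselsFrohlichANT1967, Ch. VII §11.2 (bis)] -/
theorem classBarInv_inflG_comp_boundary (E : GalLayer F) {S : ShortComplex (DiscreteRepCat ℤ (absoluteGaloisGroup F))}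
    (hS : S.ShortExact)
    (hSU : (S.map (invariantsQuotFunctor ℤ (E.openNormalSubgroup : Subgroup (absoluteGaloisGroup F)))).ShortExact)
    (c : groupCohomology ((invariantsQuotFunctor ℤ (E.openNormalSubgroup : Subgroup (absoluteGaloisGroup F))).obj S.X₃) 1)
    (u : S.X₁ ⟶ classBarD F) :
    classBarInv F ((LayerColimit.inflG E.openNormalSubgroup S.X₃ 1 c).comp (ExtPresentation.boundary hS (classBarD F) u)
        (rfl : 1 + 1 = 2)) =
      layerInv E ((groupCohomology.map (MonoidHom.id _)
        ((invariantsQuotFunctor ℤ (E.openNormalSubgroup : Subgroup (absoluteGaloisGroup F))).map u) 2).hom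
          ((groupCohomology.δ hSU 1 2 rfl).hom c)) :=
  (congrArg (classBarInv F) (LayerColimit.inflG_comp_boundary E.openNormalSubgroup hS hSU 1 c u)).trans
    (classBarInv_inflG E _)

/-- **The same in the cell's `inv_{E/F}`**: `inv_F (Inf_E c ∘ ∂_{C̄}(u)) = classInvAll F E (iso_E (u^{U_E}_* (δ c)))`
(door-c5's `layerCohomologyIso E 2 : H²(Γ_F ⧸ U_E, C̄^{U_E}) ≅ H²(Gal(E/F), C_E)`).
[cite: CasselsFrohlichANT1967, Ch. VII §11.2 (bis)][cite: MilneADT2006, I §4, proof of Theorem 4.10] -/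
theorem classBarInv_inflG_comp_boundary_eq_classInvAll (E : GalLayer F)
    {S : ShortComplex (DiscreteRepCat ℤ (absoluteGaloisGroup F))} (hS : S.ShortExact)
    (hSU : (S.map (invariantsQuotFunctor ℤ (E.openNormalSubgroup : Subgroup (absoluteGaloisGroup F)))).ShortExact)
    (c : groupCohomology ((invariantsQuotFunctor ℤ (E.openNormalSubgroup : Subgroup (absoluteGaloisGroup F))).obj S.X₃) 1)
    (u : S.X₁ ⟶ classBarD F) :
    classBarInv F ((LayerColimit.inflG E.openNormalSubgroup S.X₃ 1 c).comp (ExtPresentation.boundary hS (classBarD F) u)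
        (rfl : 1 + 1 = 2)) =
      (haveI := E.numberField; haveI := E.isGalois;
        IdeleCohomology.classInvAll F E.1 ((layerCohomologyIso E 2).hom
          ((groupCohomology.map (MonoidHom.id _)
            ((invariantsQuotFunctor ℤ (E.openNormalSubgroup : Subgroup (absoluteGaloisGroup F))).map u) 2).hom
              ((groupCohomology.δ hSU 1 2 rfl).hom c)))) :=
  (classBarInv_inflG_comp_boundary E hS hSU c u).trans (layerInv_apply E _)

/-- **Every `ŷ ∈ Ext¹_{C_Γ}(ℤ, X₃)` is `Inf_E c` for some layer `E` and `c ∈ H¹(Γ_F ⧸ U_E, X₃^{U_E})`** (door-c4 (d) re-indexed by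
the layers: every open normal subgroup of `Γ_F` is a `U_E`). [cite: SerreGaloisCohomology1997, I §2.2 Proposition 8] -/
theorem exists_layer_inflG_eq (X : DiscreteRepCat ℤ (absoluteGaloisGroup F)) (n : ℕ)
    (y : Ext (triv (k := ℤ) (Γ := absoluteGaloisGroup F) ℤ) X n) :
    ∃ (E : GalLayer F) (c : groupCohomology
      ((invariantsQuotFunctor ℤ (E.openNormalSubgroup : Subgroup (absoluteGaloisGroup F))).obj X) n),
      LayerColimit.inflG E.openNormalSubgroup X n c = y := by
  obtain ⟨V, c, rfl⟩ := LayerColimit.exists_inflG_eq n X y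
  refine ⟨GalLayer.ofOpenNormalSubgroup V, ?_⟩
  rw [GalLayer.openNormalSubgroup_ofOpenNormalSubgroup]
  exact ⟨c, rfl⟩

end IdeleClassBar

end Literature.NumberTheory.GaloisRepresentations

end
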